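import Literature.AnabelianGeometry.SemiGraphs.SurfaceTypeModels
import HarnessLib

/-!
# A NODAL model of "semi-graph of anabelioids of surface type" ([SemiAnbd] Example 2.10)

Mochizuki, *Semi-graphs of anabelioids*, Publ. RIMS **42** (2006) 221–322, Example 2.10 p. 31
[cite: MochizukiSemiAnbd2006, Ex. 2.10 p.31]: semi-graphs of anabelioids of surface type arise from
POINTED STABLE curves — irreducible components ↦ vertices (with `Π_v` the pro-`Σ` fundamental group of
the component minus nodes and marked points), nodes ↦ closed edges, marked points (cusps) ↦ open
edges, each branch attached through the inertia group of the corresponding cusp of the component.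
`SurfaceTypeModels.lean` built the SMOOTH model (one vertex, no node).  This proof-only file adds a
model WITH A NODE, through the same bridge `ProfiniteSemiGraph.isOfSurfaceType_toAnab`: the dual
semi-graph of the stable curve obtained by gluing two copies of a smooth `(k+1)`-pointed curve of
genus `g` at their first marked points —

* two vertices `v₀, v₁`, both with vertex group a pro-`Σ` completion `P` of `Γ_{g,k+1}`;
* one CLOSED edge (the node) joining `v₀` to `v₁`, with edge group `Ī₀ ⊆ P` (the closed inertia
  group of cusp `0`) included into both vertex groups;
* `2k` open edges (the remaining marked points), with edge groups `Ī_{j+1}`;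

it is of injective type, connected, every edge abuts to a vertex, the node is a closed edge joining
two distinct vertices, for `k = 0` the underlying semi-graph is a GRAPH (a compact curve of genus
`2g` with one separating node), and its semi-graph of anabelioids is of surface type
(`exists_isOfSurfaceType_nodal`).  Also a general §1 lemma: a semi-graph all of whose edges abut to
some vertex and all of whose vertex-points are mutually reachable is connected.

A model certifies satisfiability only; nothing here takes a side on [IUTchIII] Cor. 3.12.
Theorems only.
-/

noncomputable section

namespace Literature.AnabelianGeometry.SemiGraphs

open CategoryTheory
open Literature.AnabelianGeometry.Anabelioids
open Literature.GroupTheory.CombinatorialGroupTheory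
open scoped Pointwise Topology

universe u

/-- A semi-graph in which every edge abuts to some vertex and every vertex-point of the subdivision
is reachable from a fixed vertex-point is connected. [cite: MochizukiSemiAnbd2006, §1 pp.11-13] -/
theorem SemiGraph.isConnected_of_reachable_of_edgeAbuts (G : SemiGraph.{u}) (v₀ : G.Vertex)
    (hV : ∀ v : G.Vertex, G.subdivision.Reachable (Sum.inl v₀) (Sum.inl v))
    (hE : ∀ e : G.Edge, ∃ v : G.Vertex, G.EdgeAbuts e v) : G.IsConnected := by
  have hed : ∀ e : G.Edge, G.subdivision.Reachable (Sum.inl v₀) (Sum.inr (Sum.inl e)) := by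
    intro e
    obtain ⟨v, b, hbe, hb⟩ := hE e
    refine ((hV v).trans
      (G.subdivision_adj_of_nodeRel (SemiGraph.NodeRel.branch_vertex b v hb)).reachable.symm).trans ?_
    rw [← hbe]
    exact (G.subdivision_adj_of_nodeRel (SemiGraph.NodeRel.edge_branch b)).reachable.symm
  have hall : ∀ x : G.Node, G.subdivision.Reachable (Sum.inl v₀) x := by
    rintro (v | e | b)
    · exact hV v
    · exact hed e
    · exact (hed (G.edgeOf b)).trans
        (G.subdivision_adj_of_nodeRel (SemiGraph.NodeRel.edge_branch b)).reachable
  haveI : Nonempty G.Node := ⟨Sum.inl v₀⟩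
  exact ⟨⟨fun x y => (hall x).symm.trans (hall y)⟩⟩

namespace ProfiniteSemiGraph

/-- **A surface-type model with a node, over a given pro-`Σ` completion** `ι : Γ_{g,k+1} → P`: the
dual semi-graph of two smooth `(k+1)`-pointed genus-`g` curves glued at their first marked points
(two vertices with group `P`; one closed edge with group `Ī₀ = closure ι(⟨c₀⟩)` included into both;
`2k` open edges with groups `Ī_{j+1}`) is of injective type, connected, every edge abuts to a vertex,
its node is a closed edge joining the two (distinct) vertices, it is a graph when `k = 0`, and its
semi-graph of anabelioids is of surface type ([SemiAnbd] Ex. 2.10, pointed stable curve with one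
node). [cite: MochizukiSemiAnbd2006, Ex. 2.10 p.31] -/
theorem exists_isOfSurfaceType_nodal_of_isProSigmaCompletion (Sigma : Set ℕ)
    (hSigma : Sigma.Nonempty ∧ ∀ p ∈ Sigma, p.Prime) (g k : ℕ)
    (hgr : PuncturedSurfaceGroup.IsHyperbolicType g (k + 1)) (P : Type) [Group P]
    [TopologicalSpace P] [IsTopologicalGroup P] [CompactSpace P] [TotallyDisconnectedSpace P]
    (ι : PuncturedSurfaceGroup g (k + 1) →* P)
    (hι : SemiGraphOfAnabelioids.IsProSigmaCompletion Sigma ι) :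
    ∃ 𝔊 : ProfiniteSemiGraph.{0},
      Nonempty (𝔊.graph.Vertex ≃ Bool) ∧ Nonempty (𝔊.graph.Edge ≃ Option (Bool × Fin k)) ∧
        (∃ e : 𝔊.graph.Edge, 𝔊.graph.IsClosedEdge e ∧
          ∃ v w : 𝔊.graph.Vertex, v ≠ w ∧ 𝔊.graph.Joins e v w) ∧
        𝔊.toAnab.EveryEdgeAbuts ∧ 𝔊.toAnab.IsConnected ∧ 𝔊.IsOfInjectiveType ∧
        (k = 0 → 𝔊.IsGraph) ∧
        (∀ v, Nonempty (𝔊.Gv v ≃ₜ* P) ∧ ∃ ιv : PuncturedSurfaceGroup g (k + 1) →* 𝔊.Gv v,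
          SemiGraphOfAnabelioids.IsProSigmaCompletion Sigma ιv ∧
            ∃ js : 𝔊.graph.Star v → Fin (k + 1), Function.Injective js ∧ ∀ b : 𝔊.graph.Star v,
              𝔊.branchSubgroup b.1 v b.2 =
                ((PuncturedSurfaceGroup.cuspInertia (g := g) (js b)).map ιv).topologicalClosure) ∧
        𝔊.toAnab.IsOfSurfaceType Sigma := by
  -- the cusp through which an edge is attached: the node through cusp `0`, the open edge
  -- `(i, j)` through cusp `j + 1`
  let cusp : Option (Bool × Fin k) → Fin (k + 1) := fun e => e.elim 0 fun p => p.2.succ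
  let K : Option (Bool × Fin k) → Subgroup P := fun e =>
    ((PuncturedSurfaceGroup.cuspInertia (g := g) (cusp e)).map ι).topologicalClosure
  haveI hKc : ∀ e, CompactSpace ↥(K e) := fun e =>
    isCompact_iff_compactSpace.mp (Subgroup.isClosed_topologicalClosure _).isCompact
  -- the underlying semi-graph: branches `inl i` of the node (abutting to `i`), `inr (inl (i, j))`
  -- (abutting to `i`) and `inr (inr (i, j))` (free) of the open edge `(i, j)`
  let Γ₀ : SemiGraph.{0} :=
    { Vertex := Bool
      Edge := Option (Bool × Fin k)
      Branch := Bool ⊕ ((Bool × Fin k) ⊕ (Bool × Fin k))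
      edgeOf := Sum.elim (fun _ => none) (Sum.elim some some)
      abuts := Sum.elim (fun i => some i) (Sum.elim (fun p => some p.1) fun _ => none)
      two_branches := by
        rintro (_ | p)
        · refine ⟨Sum.inl false, Sum.inl true, by simp, rfl, rfl, ?_⟩
          rintro (i | p | p) hb
          · cases i
            · exact Or.inl rfl
            · exact Or.inr rfl
          · exact absurd hb (by simp)
          · exact absurd hb (by simp)
        · refine ⟨Sum.inr (Sum.inl p), Sum.inr (Sum.inr p), by simp, rfl, rfl, ?_⟩
          rintro (i | q | q) hb
          · exact absurd hb (by simp)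
          · left; simp only [Sum.elim_inr, Sum.elim_inl, Option.some.injEq] at hb; rw [hb]
          · right; simp only [Sum.elim_inr, Option.some.injEq] at hb; rw [hb] }
  let 𝔊 : ProfiniteSemiGraph.{0} :=
    { graph := Γ₀
      Gv := fun _ => P
      Ge := fun e => ↥(K e)
      brHom := fun b _ _ => { (K (Γ₀.edgeOf b)).subtype with continuous_toFun := continuous_subtype_val } }
  -- branches at a vertex: the node branch or the abutting branch of an open edge at that vertex
  have hstar : ∀ (i : 𝔊.graph.Vertex) (b : 𝔊.graph.Star i),
      b.1 = Sum.inl i ∨ ∃ j : Fin k, b.1 = Sum.inr (Sum.inl (i, j)) := by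
    rintro i ⟨(i' | ⟨i', j⟩ | p), hb⟩
    · left
      have : i' = i := by simpa [𝔊, Γ₀] using hb
      subst this
      rfl
    · right
      have : i' = i := by simpa [𝔊, Γ₀] using hb
      subst this
      exact ⟨j, rfl⟩
    · exact absurd hb (by simp [𝔊, Γ₀])
  let js : ∀ i : 𝔊.graph.Vertex, 𝔊.graph.Star i → Fin (k + 1) := fun i b => cusp (Γ₀.edgeOf b.1)
  have hjs : ∀ i, Function.Injective (js i) := by
    intro i b b' h
    apply Subtype.ext
    rcases hstar i b with hb | ⟨j, hb⟩ <;> rcases hstar i b' with hb' | ⟨j', hb'⟩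
    · rw [hb, hb']
    · exact absurd h (by simp [js, cusp, hb, hb', Γ₀, (Fin.succ_ne_zero j').symm])
    · exact absurd h (by simp [js, cusp, hb, hb', Γ₀, Fin.succ_ne_zero j])
    · have hjj : j = j' := by simpa [js, cusp, hb, hb', Γ₀, Fin.succ_inj] using h
      rw [hb, hb', hjj]
  have hbs : ∀ (i : 𝔊.graph.Vertex) (b : 𝔊.graph.Star i),
      𝔊.branchSubgroup b.1 i b.2 =
        ((PuncturedSurfaceGroup.cuspInertia (g := g) (js i b)).map ι).topologicalClosure :=
    fun i b => Subgroup.range_subtype _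
  refine ⟨𝔊, ⟨Equiv.refl _⟩, ⟨Equiv.refl _⟩, ?_, ?_, ?_, ?_, ?_, ?_, ?_⟩
  · -- the node is a closed edge joining the two vertices
    refine ⟨none, ?_, false, true, Bool.false_ne_true, Sum.inl false, Sum.inl true,
      fun h => Bool.false_ne_true (Sum.inl_injective h), rfl, rfl, rfl, rfl⟩
    have hvp : 𝔊.graph.verticialPortion none = {Sum.inl false, Sum.inl true} := by
      ext b
      simp only [SemiGraph.verticialPortion, Set.mem_setOf_eq, Set.mem_insert_iff,
        Set.mem_singleton_iff]
      constructor
      · rintro ⟨hb, -⟩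
        rcases b with (i | p | p)
        · cases i
          · exact Or.inl rfl
          · exact Or.inr rfl
        · exact absurd hb (by simp [𝔊, Γ₀])
        · exact absurd hb (by simp [𝔊, Γ₀])
      · rintro (rfl | rfl) <;> exact ⟨rfl, rfl⟩
    change (𝔊.graph.verticialPortion none).ncard = 2
    rw [hvp]
    exact Set.ncard_pair fun h => Bool.false_ne_true (Sum.inl_injective h)
  · -- every edge abuts to a vertex
    rintro (_ | ⟨i, j⟩)
    · exact ⟨Sum.inl false, false, rfl, rfl⟩
    · exact ⟨Sum.inr (Sum.inl (i, j)), i, rfl, rfl⟩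
  · -- connected: `v₁` is reached from `v₀` through the node
    refine ⟨𝔊.graph.isConnected_of_reachable_of_edgeAbuts false (fun i => ?_) ?_⟩
    · cases i
      · exact SimpleGraph.Reachable.refl _
      · exact (((𝔊.graph.subdivision_adj_of_nodeRel
            (SemiGraph.NodeRel.branch_vertex (Sum.inl false) false rfl)).reachable.symm.trans
          (𝔊.graph.subdivision_adj_of_nodeRel
            (SemiGraph.NodeRel.edge_branch (Sum.inl false))).reachable.symm).trans
          (𝔊.graph.subdivision_adj_of_nodeRel
            (SemiGraph.NodeRel.edge_branch (Sum.inl true))).reachable).trans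
          (𝔊.graph.subdivision_adj_of_nodeRel
            (SemiGraph.NodeRel.branch_vertex (Sum.inl true) true rfl)).reachable
    · rintro (_ | ⟨i, j⟩)
      · exact ⟨false, Sum.inl false, rfl, rfl⟩
      · exact ⟨i, Sum.inr (Sum.inl (i, j)), rfl, rfl⟩
  · -- of injective type: the `b_*` are subgroup inclusions
    exact fun b v h => Subtype.val_injective
  · -- a graph when `k = 0`: then there are no open edges
    rintro rfl
    refine ⟨?_⟩
    rintro (i | ⟨_, j⟩ | ⟨_, j⟩)
    · rfl
    · exact j.elim0
    · exact j.elim0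
  · -- the vertex groups and branch groups
    intro i
    exact ⟨⟨ContinuousMulEquiv.refl P⟩, ι, hι, js i, hjs i, hbs i⟩
  · -- of surface type, by the bridge
    refine 𝔊.isOfSurfaceType_toAnab Sigma hSigma (fun b v h => Subtype.val_injective) fun i =>
      ⟨g, k + 1, ι, hgr, hι, js i, hjs i, fun b => ⟨1, ?_⟩⟩
    rw [map_one, one_smul]
    exact hbs i b

/-- **Example 2.10 has a model WITH A NODE**: for every nonempty set of primes `Σ` and every
hyperbolic `(g, k+1)`, the dual semi-graph of two smooth `(k+1)`-pointed genus-`g` curves glued at a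
marked point (pro-`Σ` completion from `IsProSigmaCompletion.exists_isProSigmaCompletion`) is a
semi-graph of profinite groups of injective type, connected, with a closed edge joining two distinct
vertices, every edge abutting to a vertex, a graph when `k = 0`, whose semi-graph of anabelioids is
of surface type. [cite: MochizukiSemiAnbd2006, Ex. 2.10 p.31] -/
theorem exists_isOfSurfaceType_nodal (Sigma : Set ℕ) (hSigma : Sigma.Nonempty ∧ ∀ p ∈ Sigma, p.Prime)
    (g k : ℕ) (hgr : PuncturedSurfaceGroup.IsHyperbolicType g (k + 1)) :
    ∃ 𝔊 : ProfiniteSemiGraph.{0},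
      Nonempty (𝔊.graph.Vertex ≃ Bool) ∧ Nonempty (𝔊.graph.Edge ≃ Option (Bool × Fin k)) ∧
        (∃ e : 𝔊.graph.Edge, 𝔊.graph.IsClosedEdge e ∧
          ∃ v w : 𝔊.graph.Vertex, v ≠ w ∧ 𝔊.graph.Joins e v w) ∧
        𝔊.toAnab.EveryEdgeAbuts ∧ 𝔊.toAnab.IsConnected ∧ 𝔊.IsOfInjectiveType ∧
        (k = 0 → 𝔊.IsGraph) ∧
        (∀ v, ∃ ιv : PuncturedSurfaceGroup g (k + 1) →* 𝔊.Gv v,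
          SemiGraphOfAnabelioids.IsProSigmaCompletion Sigma ιv ∧
            ∃ js : 𝔊.graph.Star v → Fin (k + 1), Function.Injective js ∧ ∀ b : 𝔊.graph.Star v,
              𝔊.branchSubgroup b.1 v b.2 =
                ((PuncturedSurfaceGroup.cuspInertia (g := g) (js b)).map ιv).topologicalClosure) ∧
        𝔊.toAnab.IsOfSurfaceType Sigma := by
  obtain ⟨P, ι, hι⟩ := SemiGraphOfAnabelioids.IsProSigmaCompletion.exists_isProSigmaCompletion
    (PuncturedSurfaceGroup g (k + 1)) Sigma
  obtain ⟨𝔊, h1, h2, h3, h4, h5, h6, h7, h8, h9⟩ :=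
    exists_isOfSurfaceType_nodal_of_isProSigmaCompletion Sigma hSigma g k hgr P ι hι
  exact ⟨𝔊, h1, h2, h3, h4, h5, h6, h7, fun v => (h8 v).2, h9⟩

end ProfiniteSemiGraph

/-- **A surface-type semi-graph of anabelioids with a node** (§2 presentation): for every nonempty
set of primes `Σ` and hyperbolic `(g, k+1)` there is a connected semi-graph of anabelioids of surface
type with two vertices, a closed edge joining them and `2k` further (open) edges, every edge abutting
to a vertex; for `k = 0` it is a graph of anabelioids ([SemiAnbd] Ex. 2.10, pointed stable curve
with one node). [cite: MochizukiSemiAnbd2006, Ex. 2.10 p.31] -/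
theorem SemiGraphOfAnabelioids.exists_isOfSurfaceType_nodal (Sigma : Set ℕ)
    (hSigma : Sigma.Nonempty ∧ ∀ p ∈ Sigma, p.Prime) (g k : ℕ)
    (hgr : PuncturedSurfaceGroup.IsHyperbolicType g (k + 1)) :
    ∃ 𝒢 : SemiGraphOfAnabelioids.{0, 1, 0},
      𝒢.IsOfSurfaceType Sigma ∧ 𝒢.EveryEdgeAbuts ∧ 𝒢.IsConnected ∧
        Nonempty (𝒢.graph.Vertex ≃ Bool) ∧ Nonempty (𝒢.graph.Edge ≃ Option (Bool × Fin k)) ∧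
        (∃ e : 𝒢.graph.Edge, 𝒢.graph.IsClosedEdge e ∧
          ∃ v w : 𝒢.graph.Vertex, v ≠ w ∧ 𝒢.graph.Joins e v w) ∧
        (k = 0 → 𝒢.IsGraphOfAnabelioids) := by
  obtain ⟨𝔊, h1, h2, h3, h4, h5, -, h7, -, h9⟩ :=
    ProfiniteSemiGraph.exists_isOfSurfaceType_nodal Sigma hSigma g k hgr
  exact ⟨𝔊.toAnab, h9, h4, h5, h1, h2, h3, fun hk => ⟨h7 hk⟩⟩

end Literature.AnabelianGeometry.SemiGraphs

end
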